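import Literature.NumberTheory.Automorphic.HidaEngineWeightBridge
import Literature.NumberTheory.Automorphic.HidaLatticeHeckeCommutative
import Literature.NumberTheory.Automorphic.HidaEngineContinuity
import HarnessLib

/-!
# The weight bridge intertwines the polynomial actions (with the weight twist) — engine form

Topic `NumberTheory/Automorphic`; namespace `Literature.NumberTheory.Automorphic.BigHeckeGLn.TameLevel`
(and `…IntegralWeightGL2` for two memberships); definitions with bodies and theorems (no named fact,
no `sorry`).

The levelwise support argument for Hida's control theorem ([Hida1994AIF, §3, Thm 3.2];
[KhareThorne2017, §6.5, Lemma 6.17]) runs on the level modules `E_n(j) = Ord H^j(X_{U(lv n)}, O/pⁿ)`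
(`HidaEngineModules`) and is fed from the lattice side `H^j(U(lv n), ⨂_τ Sym^{k−2}((O/pⁿ)²))` through
the weight bridge `Φ` (`HidaEngineWeightBridge`).  Here:

* `weightBridge_symPolyHom_apply` — **`Φ (π(z) y) = ρ(θ_k z) (Φ y)`**: `Φ` intertwines the polynomial
  action `π` of the symbol ring `O[Syms]` on the lattice side (`symPolyHom`, `X_g ↦ [UgU]`,
  `X_d ↦ ⟨d⟩`) with the action `ρ ∘ θ_k` on `H^j(X_{U(lv n)}, O/pⁿ)`, `θ_k = symTwist` the weight twist
  `X_d ↦ N(u¹_d)^{k−2} X_d` — GIVEN the compatibility `hN` of the place maps with the norm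
  (`∏_τ red_τ(û¹_d) ^ (k−2) = N(u¹_d)^{k−2}` in `O/pⁿ`);
* `EngModTw` — the level module `E_n(j)` with the TWISTED `O[Syms]`-structure `z • m = ρ(θ_k z) m`, so
  that `Φ` becomes `O[Syms]`-linear from `(Ord H^j(U, Sym), π)`; `coe_twSmul`,
  `twSmul_mk_weightBridge` (the bridge formula on ordinary classes);
* `exists_forall_norm_symChar_symTwist_lt` — hypothesis `hD` of the engine for the twisted modules and
  the twisted character `χ ∘ θ_k` (from `HidaEngineContinuity.exists_forall_norm_symChar_lt`);
* `bijOn_weightBridge_symOrd_engOrd` — `Φ` is a bijection from the `U_p`-ordinary part of the lattice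
  side onto `E_n(j)` (restating `bijOn_weightBridge`).

## References

* H. Hida, Ann. Inst. Fourier 44 (1994), §2 Prop. 2.1, §3 Thm 3.2 (held). [Hida1994AIF]
* C. Khare, J. A. Thorne, Amer. J. Math. 139 (2017), §6.4 Prop. 6.13, §6.5 Lemma 6.17
  (arXiv:1409.7007, held). [KhareThorne2017]
-/

noncomputable section

open CategoryTheory IsDedekindDomain MvPolynomial
open scoped NumberField

namespace Literature.NumberTheory.Automorphic

/-! ### Two memberships in the multi-place Iwahori monoid -/

namespace IntegralWeightGL2

open BigHeckeGLn

variable {K : Type} [Field K] [NumberField K] {S : Type} [CommRing S] {J : Type} [Fintype J]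
  {v : J → HeightOneSpectrum (𝓞 K)} (red : ∀ j : J, (v j).adicCompletionIntegers K →+* S)

omit [Fintype J] in
/-- `t_{w,i}` lies in the multi-place Iwahori monoid when `w` is none of the index places. [folklore] -/
theorem heckeElement_mem_multiIwahoriMonoid_of_forall_ne {w : HeightOneSpectrum (𝓞 K)} (hw : ∀ j, v j ≠ w) (i : ℕ) :
    heckeElement 2 K w i ∈ multiIwahoriMonoid K v red :=
  mem_multiIwahoriMonoid_iff.2 fun j =>
    mem_iwahoriMonoid_of_localComponent_eq (g' := 1)
      (by rw [localComponent_heckeElement_of_ne (hw j), map_one]) (Submonoid.one_mem _)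

omit [Fintype J] in
variable {p : ℕ} [Fact p.Prime] in
/-- The diamonds `diamondPi u` lie in the multi-place Iwahori monoid (index places above `p`). [folklore] -/
theorem diamondPi_mem_multiIwahoriMonoid (hv : ∀ j, (p : 𝓞 K) ∈ (v j).asIdeal)
    (u : ∀ w : PlacesAbove K p, (Fin 2 → (w.1.adicCompletionIntegers K)ˣ)) :
    diamondPi 2 K p u ∈ multiIwahoriMonoid K v red :=
  mem_multiIwahoriMonoid_iff.2 fun j =>
    mem_iwahoriMonoid_of_localComponent_eq (g' := diamondElement 2 K (v j) (u ⟨v j, hv j⟩))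
      (by rw [localComponent_diamondPi u ⟨v j, hv j⟩, diamondElement_apply, localComponent_ofLocal])
      (diamondElement_mem_iwahoriMonoid (red j) _)

end IntegralWeightGL2

namespace BigHeckeGLn

namespace TameLevel

open IntegralWeightGL2 LevelAction ParallelWeight PolyAction

/-- **The place maps modulo `pⁿ`**: `red_{n,τ} = (O → O/pⁿ) ∘ φO_τ`. [folklore] -/
abbrev engRed {F : Type} [Field F] [NumberField F] (p : ℕ) (O : Type) [CommRing O] {E : Type} [Field E]
    {v : (F →+* E) → HeightOneSpectrum (𝓞 F)} (φO : ∀ τ : F →+* E, (v τ).adicCompletionIntegers F →+* O)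
    (n : ℕ) (τ : F →+* E) : (v τ).adicCompletionIntegers F →+* engCoeff p O n :=
  (Ideal.Quotient.mk (Ideal.span {((p : O)) ^ n})).comp (φO τ)

variable {F : Type} [Field F] [NumberField F] {p : ℕ} [Fact p.Prime] (𝒰 : TameLevel 2 F p)
  (O : Type) [CommRing O] {E : Type} [Field E] [CharZero E] (lv : ℕ → ℕ)
  {v : (F →+* E) → HeightOneSpectrum (𝓞 F)} (hv : ∀ τ, (p : 𝓞 F) ∈ (v τ).asIdeal)
  (φO : ∀ τ : F →+* E, (v τ).adicCompletionIntegers F →+* O) (n : ℕ)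
  (hred : ∀ τ (x : (v τ).adicCompletionIntegers F),
    Valued.v (x : (v τ).adicCompletion F) ≤ (WithZero.exp (-(lv n : ℤ)) : WithZero (Multiplicative ℤ)) →
      engRed p O φO n τ x = 0)

omit [CharZero E] in
include hv hred in
/-- The engine level `U(lv n, max(lv n, 1))` lies in the integral monoid. [folklore] -/
theorem engLevel_le_integralMonoid :
    (𝒰.level (lv n) (max (lv n) 1)).toSubmonoid ≤ integralMonoid F v :=
  𝒰.level_le_integralMonoid' hv (engRed p O φO n) (le_max_left _ _) hred

/-- **The lattice side of the engine**: `H^j(U(lv n), ⨂_τ Sym^{k−2}((O/pⁿ)²))`. [cite: KhareThorne2017, §6.4] -/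
abbrev latCohomology (k j : ℕ) : ModuleCat (engCoeff p O n) :=
  LevelAction.cohomology (globalEmbedding 2 F) (integralMonoid F v)
    (symLatticeAction (engCoeff p O n) E F k v (engRed p O φO n)) (𝒰.level (lv n) (max (lv n) 1)) j

/-- **The polynomial action `π` of `O[Syms]` on the lattice side** (`symPolyHom`). [cite: KhareThorne2017, §6.5] -/
def latPolyHom [h𝒰 : Fact 𝒰.IsMaximalAbove] (k c₀ j : ℕ) :
    MvPolynomial (𝒰.Syms c₀) O →+* Module.End (engCoeff p O n) (𝒰.latCohomology O lv φO n k j) :=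
  𝒰.symPolyHom (symLatticeAction (engCoeff p O n) E F k v (engRed p O φO n))
    (𝒰.engLevel_le_integralMonoid O lv hv φO n hred) c₀
    (fun _ hg => 𝒰.goodElements_le_integralMonoid v hg) (fun u => diamondPi_mem_integralMonoid' v hv u)
    (Ideal.Quotient.mk _) h𝒰.out j

/-- **The `U_p`-ordinary part of the lattice side** (`symOrd`). [cite: KhareThorne2017, §2.4] -/
def latOrd (k j : ℕ) : Submodule (engCoeff p O n) (𝒰.latCohomology O lv φO n k j) :=
  𝒰.symOrd (symLatticeAction (engCoeff p O n) E F k v (engRed p O φO n))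
    (𝒰.engLevel_le_integralMonoid O lv hv φO n hred) (fun w => heckeElement_mem_integralMonoid v w.1 1) j

/-- **The weight bridge of the engine** `Φ : H^j(U(lv n), Sym) → H^j(X_{U(lv n)}, O/pⁿ)`. [cite: KhareThorne2017, §6.4, Prop. 6.13] -/
def engBridge (k j : ℕ) : 𝒰.latCohomology O lv φO n k j →ₗ[engCoeff p O n] 𝒰.engCohomology O lv n j :=
  𝒰.weightBridge k hv (engRed p O φO n) (le_max_left (lv n) 1) hred j

omit [CharZero E] in
/-- `π(z)` preserves the ordinary part. [folklore] -/
theorem latPolyHom_apply_mem_latOrd [h𝒰 : Fact 𝒰.IsMaximalAbove] {k c₀ : ℕ} (j : ℕ) (z : MvPolynomial (𝒰.Syms c₀) O)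
    {y : 𝒰.latCohomology O lv φO n k j} (hy : y ∈ 𝒰.latOrd O lv hv φO n hred k j) :
    𝒰.latPolyHom O lv hv φO n hred k c₀ j z y ∈ 𝒰.latOrd O lv hv φO n hred k j :=
  𝒰.symPolyHom_apply_mem_symOrd _ _ _ h𝒰.out j z hy

/-! ### The bridge formula -/

section Formula

variable [h𝒰 : Fact 𝒰.IsMaximalAbove] {k c₀ : ℕ}
  (hN : ∀ d : TorusDatum F p c₀,
    (∏ τ, engRed p O φO n τ ((d.units ⟨v τ, hv τ⟩ 1 : ((v τ).adicCompletionIntegers F)ˣ) :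
        (v τ).adicCompletionIntegers F) ^ (k - 2)) =
      Ideal.Quotient.mk (Ideal.span {((p : O)) ^ n}) (((Algebra.norm ℤ d.2.u : ℤ) : O) ^ (k - 2)))

include hN in
/-- **`Φ (π(z) y) = ρ(θ_k z) (Φ y)`**: the weight bridge intertwines `π` with the twisted action
`ρ ∘ symTwist` on `H^j(X_{U(lv n)}, O/pⁿ)`. [cite: KhareThorne2017, §6.4, Prop. 6.13; §6.5] [cite: Hida1994AIF, §2, Prop. 2.1] -/
theorem weightBridge_symPolyHom_apply (j : ℕ) (z : MvPolynomial (𝒰.Syms c₀) O) (y : 𝒰.latCohomology O lv φO n k j) :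
    𝒰.engBridge O lv hv φO n hred k j (𝒰.latPolyHom O lv hv φO n hred k c₀ j z y) =
      𝒰.engPolyHomFull n j (𝒰.symTwist O c₀ k z) (𝒰.engBridge O lv hv φO n hred k j y) := by
  have hbad : ∀ τ, v τ ∈ 𝒰.bad := fun τ => 𝒰.mem_bad_of_mem (v τ) (hv τ)
  refine map_polyHom_apply (φ := Ideal.Quotient.mk _) (𝒰.symOp_comm _ _ h𝒰.out j) (𝒰.engFamily_comm n j)
    (𝒰.symTwist O c₀ k) (𝒰.symTwist_C k) (𝒰.engBridge O lv hv φO n hred k j).toAddMonoidHom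
    (fun a m => ?_) (fun r m => ?_) z y
  · change 𝒰.engBridge O lv hv φO n hred k j (𝒰.symOp _ _ c₀ _ _ j a m) = _
    rcases a with ⟨g, hg⟩ | d
    · -- a good Hecke element: no twist
      obtain ⟨w, hw, i, rfl⟩ := hg
      have hne : ∀ τ, v τ ≠ w := fun τ h => hw (h ▸ hbad τ)
      have hgm : heckeElement 2 F w i ∈ multiIwahoriMonoid F v (engRed p O φO n) :=
        heckeElement_mem_multiIwahoriMonoid_of_forall_ne _ hne i
      have h := LinearMap.congr_fun (𝒰.weightBridge_comp_heckeCohomology_of_forall k hv (engRed p O φO n)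
        (le_max_left (lv n) 1) hred hgm (fun τ => localComponent_heckeElement_of_ne (hne τ) i) j) m
      rw [LinearMap.comp_apply, LinearMap.comp_apply] at h
      rw [symTwist_X_inl, polyHom_X, engFamily_inl, symOp_inl]
      exact h
    · -- a torus datum: the weight twist
      have hdm : diamondPi 2 F p d.units ∈ multiIwahoriMonoid F v (engRed p O φO n) :=
        diamondPi_mem_multiIwahoriMonoid _ hv d.units
      have h := LinearMap.congr_fun (𝒰.weightBridge_comp_heckeCohomology_diamondPi k hv (engRed p O φO n)
        (le_max_left (lv n) 1) hred d.units hdm j) m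
      rw [LinearMap.comp_apply, LinearMap.smul_apply, LinearMap.comp_apply] at h
      rw [symTwist_X_inr, map_mul, Module.End.mul_apply, polyHom_X, engFamily_inr, polyHom_C_apply, symOp_inr,
        ← hN d]
      exact h
  · change 𝒰.engBridge O lv hv φO n hred k j (Ideal.Quotient.mk _ r • m) = _
    rw [map_smul]
    rfl

end Formula

/-! ### The twisted level modules -/

section Twist

/-- **`E_n(j)` with the twisted `O[Syms]`-structure `z • m = ρ(θ_k z) m`** (a type synonym of `EngMod`;
the parameters `k`, `c₀` only index the module structure). [cite: KhareThorne2017, §6.5] -/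
def EngModTw (_k _c₀ n j : ℕ) : Type :=
  𝒰.EngMod O lv n j

/-- Additive structure of the twisted level module (that of `EngMod`). [folklore] -/
instance (k c₀ n j : ℕ) : AddCommGroup (𝒰.EngModTw O lv k c₀ n j) :=
  inferInstanceAs (AddCommGroup (𝒰.EngMod O lv n j))

/-- `O/pⁿ`-module structure of the twisted level module (that of `EngMod`). [folklore] -/
instance instModuleCoeffEngModTw (k c₀ n j : ℕ) : Module (engCoeff p O n) (𝒰.EngModTw O lv k c₀ n j) :=
  inferInstanceAs (Module (engCoeff p O n) (𝒰.EngMod O lv n j))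

/-- The twisted level module is finite when `H^j` is. [folklore] -/
instance (k c₀ n j : ℕ) [Finite (𝒰.engCohomology O lv n j)] : Finite (𝒰.EngModTw O lv k c₀ n j) :=
  inferInstanceAs (Finite (𝒰.EngMod O lv n j))

/-- Its character module is finite when `H^j` is. [folklore] -/
instance (k c₀ n j : ℕ) [Finite (𝒰.engCohomology O lv n j)] : Finite (CharacterModule (𝒰.EngModTw O lv k c₀ n j)) :=
  inferInstanceAs (Finite (CharacterModule (𝒰.EngMod O lv n j)))

/-- The identification with `EngMod`. [folklore] -/
def EngModTw.toEngMod {k c₀ n j : ℕ} (m : 𝒰.EngModTw O lv k c₀ n j) : 𝒰.EngMod O lv n j := m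

/-- The identification from `EngMod`. [folklore] -/
def EngModTw.ofEngMod (k c₀ : ℕ) {n j : ℕ} (m : 𝒰.EngMod O lv n j) : 𝒰.EngModTw O lv k c₀ n j := m

/-- **The twisted action** `z • m = ρ(θ_k z) m`. [cite: KhareThorne2017, §6.5] -/
instance instModuleEngModTw [Fact 𝒰.IsMaximalAbove] (k c₀ n j : ℕ) :
    Module (MvPolynomial (𝒰.Syms c₀) O) (𝒰.EngModTw O lv k c₀ n j) :=
  Module.compHom (𝒰.EngMod O lv n j) ((𝒰.engPolyHom O c₀ lv n j).comp (𝒰.symTwist O c₀ k))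

/-- Unfolding: `z • m = (θ_k z) • m` in `EngMod`. [folklore] -/
theorem twSmul_def [Fact 𝒰.IsMaximalAbove] {k c₀ n j : ℕ} (z : MvPolynomial (𝒰.Syms c₀) O) (m : 𝒰.EngModTw O lv k c₀ n j) :
    (z • m).toEngMod = 𝒰.symTwist O c₀ k z • m.toEngMod :=
  rfl

/-- **`(z • m : H^j) = ρ(θ_k z) m`.** [folklore] -/
theorem coe_twSmul [Fact 𝒰.IsMaximalAbove] {k c₀ n j : ℕ} (z : MvPolynomial (𝒰.Syms c₀) O) (m : 𝒰.EngModTw O lv k c₀ n j) :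
    ((z • m).toEngMod : 𝒰.engCohomology O lv n j) =
      𝒰.engPolyHomFull n j (𝒰.symTwist O c₀ k z) (m.toEngMod : 𝒰.engCohomology O lv n j) :=
  𝒰.coe_engSmul _ _

/-- `z` kills the twisted module iff `θ_k z` kills `E_n(j)`. [folklore] -/
theorem forall_twSmul_eq_zero_iff [Fact 𝒰.IsMaximalAbove] {k c₀ n j : ℕ} (z : MvPolynomial (𝒰.Syms c₀) O) :
    (∀ m : 𝒰.EngModTw O lv k c₀ n j, z • m = 0) ↔ ∀ m : 𝒰.EngMod O lv n j, 𝒰.symTwist O c₀ k z • m = 0 :=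
  Iff.rfl

/-- The twisted level module is a finite `O[Syms]`-module when `H^j` is finite. [folklore] -/
instance [Fact 𝒰.IsMaximalAbove] (k c₀ n j : ℕ) [Finite (𝒰.engCohomology O lv n j)] :
    Module.Finite (MvPolynomial (𝒰.Syms c₀) O) (𝒰.EngModTw O lv k c₀ n j) :=
  Module.Finite.of_finite

/-- Its character module is a finite `O[Syms]`-module when `H^j` is finite. [folklore] -/
instance [Fact 𝒰.IsMaximalAbove] (k c₀ n j : ℕ) [Finite (𝒰.engCohomology O lv n j)] :
    Module.Finite (MvPolynomial (𝒰.Syms c₀) O) (CharacterModule (𝒰.EngModTw O lv k c₀ n j)) :=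
  Module.Finite.of_finite

/-- **Hypothesis `hD` of the engine for the twisted modules and the twisted character `χ ∘ θ_k`.**
[cite: Hida1994AIF, §3, proof of Thm 3.2] [cite: KhareThorne2017, §6.5, Lemma 6.17] -/
theorem exists_forall_norm_symChar_symTwist_lt [Fact 𝒰.IsMaximalAbove] {k c₀ : ℕ}
    (hX : BorelSerre1973_finite_groupCohomology_congruenceSubgroup)
    (hcd : ∀ (W : Subgroup (FiniteAdelicGL 2 F)),
      IsOpen (W : Set (FiniteAdelicGL 2 F)) → IsCompact (W : Set (FiniteAdelicGL 2 F)) →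
      (∀ γ ∈ W.comap (globalEmbedding 2 F), IsOfFinOrder γ → γ = 1) →
      ∀ (A : Rep ℤ (W.comap (globalEmbedding 2 F))) (q : ℕ), 3 ≤ q → Subsingleton (groupCohomology A q))
    {r₀ : ℕ}
    (hr₀ : ∀ r : ℕ, r₀ ≤ r → ∀ (g : FiniteAdelicGL 2 F) (γ : GL (Fin 2) F), IsOfFinOrder γ →
      g⁻¹ * globalEmbedding 2 F γ * g ∈ 𝒰.hidaLevel r → γ = 1)
    (x : OrdinaryHeckeAlgebraGLn 𝒰 →+* PadicAlgCl p) (hx : Continuous x)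
    (σ : O →+* PadicAlgCl p) (hσ : ∀ o, ‖σ o‖ ≤ 1) {r : ℕ} {b : Fin r → O} (hb : IsReductionBasis (p := p) O b)
    (hlv : ∀ n, n ≤ lv n) (hlv1 : ∀ n, 1 ≤ lv n) {ε : ℝ} (hε : 0 < ε) :
    ∃ n₀ : ℕ, ∀ n, n₀ ≤ n → ∀ z : MvPolynomial (𝒰.Syms c₀) O,
      (∀ m : 𝒰.EngModTw O lv k c₀ n 1, z • m = 0) → (∀ m : 𝒰.EngModTw O lv k c₀ n 2, z • m = 0) →
      ‖(𝒰.symChar O σ c₀ (𝒰.symValues x c₀)).comp (𝒰.symTwist O c₀ k) z‖ < ε := by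
  obtain ⟨n₀, hn₀⟩ := 𝒰.exists_forall_norm_symChar_lt (c₀ := c₀) hX hcd hr₀ x hx σ hσ hb hlv hlv1 hε
  exact ⟨n₀, fun n hn z h1 h2 => hn₀ n hn _
    ((𝒰.forall_twSmul_eq_zero_iff O lv z).1 h1) ((𝒰.forall_twSmul_eq_zero_iff O lv z).1 h2)⟩

end Twist

/-! ### The bridge on ordinary classes -/

section Ordinary

variable [h𝒰 : Fact 𝒰.IsMaximalAbove]

/-- **`Φ` is a bijection of the `U_p`-ordinary parts** `Ord H^j(U(lv n), Sym) → E_n(j)`, given an exponent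
`1 ≤ r ≤ max(lv n, 1)` with `red_τ(ϖ_τ)^r = 0` and finiteness of both sides. [cite: KhareThorne2017, §6.4, Prop. 6.13] -/
theorem bijOn_engBridge_latOrd_engOrd {k : ℕ} {r : ℕ} (hr1 : 1 ≤ r) (hrc : r ≤ max (lv n) 1)
    (hr : ∀ τ, engRed p O φO n τ ⟨_, uniformizerAt_mem_adicCompletionIntegers F (v τ)⟩ ^ r = 0) (j : ℕ)
    [Finite (𝒰.latCohomology O lv φO n k j)] [Finite (𝒰.engCohomology O lv n j)] :
    Set.BijOn (𝒰.engBridge O lv hv φO n hred k j) (𝒰.latOrd O lv hv φO n hred k j) (𝒰.engOrd O lv n j) :=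
  𝒰.bijOn_weightBridge k hv (engRed p O φO n) (le_max_left (lv n) 1) hred h𝒰.out hr1 hrc hr j
    (fun w w' => 𝒰.commute_up_up _ _ (fun w => heckeElement_mem_integralMonoid v w.1 1) h𝒰.out j w w')

variable {k c₀ : ℕ} (hN : ∀ d : TorusDatum F p c₀,
    (∏ τ, engRed p O φO n τ ((d.units ⟨v τ, hv τ⟩ 1 : ((v τ).adicCompletionIntegers F)ˣ) :
        (v τ).adicCompletionIntegers F) ^ (k - 2)) =
      Ideal.Quotient.mk (Ideal.span {((p : O)) ^ n}) (((Algebra.norm ℤ d.2.u : ℤ) : O) ^ (k - 2)))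

include hN in
/-- **The bridge formula on ordinary classes**: for `y` ordinary, `z • [Φ y] = [Φ (π(z) y)]` in the
twisted level module. [cite: KhareThorne2017, §6.5] -/
theorem twSmul_mk_engBridge (j : ℕ) (z : MvPolynomial (𝒰.Syms c₀) O) {y : 𝒰.latCohomology O lv φO n k j}
    (hΦy : 𝒰.engBridge O lv hv φO n hred k j y ∈ 𝒰.engOrd O lv n j)
    (hΦzy : 𝒰.engBridge O lv hv φO n hred k j (𝒰.latPolyHom O lv hv φO n hred k c₀ j z y) ∈ 𝒰.engOrd O lv n j) :
    z • (EngModTw.ofEngMod 𝒰 O lv k c₀ (EngMod.mk 𝒰 O lv _ hΦy)) =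
      EngModTw.ofEngMod 𝒰 O lv k c₀ (EngMod.mk 𝒰 O lv _ hΦzy) := by
  refine EngMod.ext 𝒰 ?_
  change ((z • EngModTw.ofEngMod 𝒰 O lv k c₀ (EngMod.mk 𝒰 O lv _ hΦy)).toEngMod : 𝒰.engCohomology O lv n j) =
    𝒰.engBridge O lv hv φO n hred k j (𝒰.latPolyHom O lv hv φO n hred k c₀ j z y)
  rw [coe_twSmul, 𝒰.weightBridge_symPolyHom_apply O lv hv φO n hred hN j z y]
  rfl

end Ordinary

end TameLevel

end BigHeckeGLn

end Literature.NumberTheory.Automorphic
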